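import Mathlib
import Summits.QuantumFields.YangMills.Theorems.MirrorModularBoostsHypercubicLimitTypedResponseVacuous
import Summits.QuantumFields.YangMills.Theorems.MirrorModularBoostsHypercubicLimitCovBookkeeping
import Summits.QuantumFields.YangMills.Theorems.HypercubicLimit.Negative.NonabelianLoadBearing
import HarnessLib

/-!
# Line `Sketch` (holomorphic coupling response) of crux `HypercubicLimit` — the card's typed transfer
# target `UniformHolomorphicResponse` is incompatible with the crux's non-triviality clause

Support file for crux `stmt-QuantumFields-16154` (`CoincidenceRotationBootstrap.HypercubicLimit` =
`MirrorModularBoosts.WeakCouplingHypercubicLimit`), line `Sketch` (card `holomorphic-coupling-response`).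

The card's C⁺, verbatim as typed in its `Sketch.lean` (`UniformHolomorphicResponse r sch m l ε₁ C₀ C₁`,
here unfolded: for every order `n`, every observed real test `f₀` and modulations `f₁ … f_n` with
pairwise disjoint supports, and every step `k`, the complex-source one-point function
`s ↦ (∫ Φ_k(f₀) e^{∑ sᵢ Φ_k(fᵢ)} dμ_k)/(∫ e^{∑ sᵢ Φ_k(fᵢ)} dμ_k)` is holomorphic on the polydisc
`‖s‖ < ε₁/(n+1)` and bounded there by `C₀ C₁ⁿ |f₀|_{m,l} ∏ |fᵢ|_{m,l}` — radius INDEPENDENT of the `fᵢ`,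
bound linear in ONE Schwartz seminorm of each), forces:

* `covariance_eq_zero_of_typedUniformResponse` — every truncated lattice two-point function of the
  renormalised curvature on a disjointly supported real pair vanishes at every `k` (order `n = 1` of the
  hypothesis at the rescaled modulation `c • f₁`, `c → ∞`, and the landed guard
  `stub_typedResponseVacuous`);
* `not_twoPointNontrivial_of_typedUniformResponse` — hence, under the crux's convergence clause, the
  crux's TwoPointNontrivial clause for the curvature species FAILS (landed
  `Negative.NonabelianLoadBearing.twoPointNontrivial_iff_lattice` + `stub_covBookkeeping`).

So no witness `(r, sch, S)` of the crux can satisfy the card's typed C⁺ for any `ε₁ > 0`: the line must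
carry the normalised version (`ResponseHolomorphy` of `Lines/Sketch.lean`).
-/

noncomputable section

open scoped SchwartzMap
open MeasureTheory ProbabilityTheory Filter Topology Complex Metric Set
open Literature.MathematicalPhysics.AQFT Literature.MathematicalPhysics.QuantumLattice
open Literature.MathematicalPhysics.QuantumFieldTheory

namespace Summit.QuantumFields.YangMills.Cruxes.HypercubicLimit.CouplingResponse

/-- Scalar multiples do not enlarge the topological support of a Schwartz function. [folklore] -/
theorem tsupport_smul_schwartz_subset {E : Type*} [NormedAddCommGroup E] [NormedSpace ℝ E] (c : ℝ)
    (f : 𝓢(E, ℝ)) : tsupport (⇑(c • f)) ⊆ tsupport (⇑f) :=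
  tsupport_smul_subset_right (fun _ : E => c) (⇑f)

/-- The constant embedding `ℂ → (Fin 1 → ℂ)` maps the disc of radius `ε` into the polydisc of radius
`ε`. [folklore] -/
theorem const_mem_ball_fin_one {ε : ℝ} {t : ℂ} (ht : t ∈ ball (0 : ℂ) ε) :
    (fun _ : Fin 1 => t) ∈ ball (0 : Fin 1 → ℂ) ε := by
  rw [mem_ball, dist_zero_right] at ht ⊢
  rwa [pi_norm_const]

/-- **The card's typed C⁺ forces vanishing off-diagonal covariances.**  If `UniformHolomorphicResponse
r sch m l ε₁ C₀ C₁` holds as typed in the card's `Sketch.lean` (unfolded in the hypothesis `hU`) with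
`0 < ε₁`, then for every step `k` and every pair of real test functions with disjoint supports the
covariance of the renormalised curvature fields `Φ_k(f₀)`, `Φ_k(f₁)` under the step-`k` Wilson measure
is zero. [folklore] -/
theorem covariance_eq_zero_of_typedUniformResponse
    {G : Type} [Group G] [TopologicalSpace G] [IsTopologicalGroup G] [CompactSpace G]
    [MeasurableSpace G] [BorelSpace G] (r : LatticeRep G) (sch : SpeciesScheme (YMSpecies G))
    (m l : ℕ) {ε₁ : ℝ} (C₀ C₁ : ℝ) (hε₁ : 0 < ε₁)
    (hU : ∀ (n : ℕ) (f₀ : 𝓢(EuclideanSpace ℝ (Fin 4), ℝ))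
      (f : Fin n → 𝓢(EuclideanSpace ℝ (Fin 4), ℝ)),
      (∀ i, Disjoint (tsupport f₀) (tsupport (f i))) →
      (∀ i j, i ≠ j → Disjoint (tsupport (f i)) (tsupport (f j))) →
        ∀ k : ℕ,
          DifferentiableOn ℂ
            (fun s : Fin n → ℂ =>
              (∫ U, ((smearedLatticeField r.curvature.F
                  (Literature.Probability.LatticeModels.box 4 (sch.L k)) (sch.a k) (sch.c r.curvature k)
                  (sch.m r.curvature k) f₀ (torusLift (sch.side k) U) : ℝ) : ℂ) *
                Complex.exp (∑ i, s i * ((smearedLatticeField r.curvature.F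
                  (Literature.Probability.LatticeModels.box 4 (sch.L k)) (sch.a k) (sch.c r.curvature k)
                  (sch.m r.curvature k) (f i) (torusLift (sch.side k) U) : ℝ) : ℂ))
                ∂(wilsonMeasure r.ρ (sch.β k) : Measure (GaugeConfig 4 (sch.side k) G))) /
              ∫ U, Complex.exp (∑ i, s i * ((smearedLatticeField r.curvature.F
                  (Literature.Probability.LatticeModels.box 4 (sch.L k)) (sch.a k) (sch.c r.curvature k)
                  (sch.m r.curvature k) (f i) (torusLift (sch.side k) U) : ℝ) : ℂ))
                ∂(wilsonMeasure r.ρ (sch.β k) : Measure (GaugeConfig 4 (sch.side k) G)))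
            (ball 0 (ε₁ / (n + 1))) ∧
          ∀ s ∈ ball (0 : Fin n → ℂ) (ε₁ / (n + 1)),
            ‖(∫ U, ((smearedLatticeField r.curvature.F
                  (Literature.Probability.LatticeModels.box 4 (sch.L k)) (sch.a k) (sch.c r.curvature k)
                  (sch.m r.curvature k) f₀ (torusLift (sch.side k) U) : ℝ) : ℂ) *
                Complex.exp (∑ i, s i * ((smearedLatticeField r.curvature.F
                  (Literature.Probability.LatticeModels.box 4 (sch.L k)) (sch.a k) (sch.c r.curvature k)
                  (sch.m r.curvature k) (f i) (torusLift (sch.side k) U) : ℝ) : ℂ))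
                ∂(wilsonMeasure r.ρ (sch.β k) : Measure (GaugeConfig 4 (sch.side k) G))) /
              ∫ U, Complex.exp (∑ i, s i * ((smearedLatticeField r.curvature.F
                  (Literature.Probability.LatticeModels.box 4 (sch.L k)) (sch.a k) (sch.c r.curvature k)
                  (sch.m r.curvature k) (f i) (torusLift (sch.side k) U) : ℝ) : ℂ))
                ∂(wilsonMeasure r.ρ (sch.β k) : Measure (GaugeConfig 4 (sch.side k) G))‖ ≤
              C₀ * C₁ ^ n * SchwartzMap.seminorm ℝ m l f₀ * ∏ i, SchwartzMap.seminorm ℝ m l (f i))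
    (k : ℕ) (f₀ f₁ : 𝓢(EuclideanSpace ℝ (Fin 4), ℝ))
    (hdisj : Disjoint (tsupport f₀) (tsupport f₁)) :
    covariance
        (fun U => smearedLatticeField r.curvature.F
          (Literature.Probability.LatticeModels.box 4 (sch.L k)) (sch.a k) (sch.c r.curvature k)
          (sch.m r.curvature k) f₀ (torusLift (sch.side k) U))
        (fun U => smearedLatticeField r.curvature.F
          (Literature.Probability.LatticeModels.box 4 (sch.L k)) (sch.a k) (sch.c r.curvature k)
          (sch.m r.curvature k) f₁ (torusLift (sch.side k) U))
        (wilsonMeasure r.ρ (sch.β k) : Measure (GaugeConfig 4 (sch.side k) G)) = 0 := by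
  have hε : 0 < ε₁ / ((1 : ℕ) + 1) := by positivity
  refine stub_typedResponseVacuous G r sch k f₀ f₁ (ε₁ / ((1 : ℕ) + 1))
    (C₀ * C₁ ^ 1 * SchwartzMap.seminorm ℝ m l f₀ * SchwartzMap.seminorm ℝ m l f₁) hε ?_
  intro c hc
  -- the typed hypothesis at order one, for the rescaled modulation `c • f₁`
  have hd1 : ∀ i : Fin 1, Disjoint (tsupport f₀) (tsupport (![c • f₁] i)) := by
    intro i
    fin_cases i
    exact hdisj.mono_right (by simpa using tsupport_smul_schwartz_subset c f₁)
  have hd2 : ∀ i j : Fin 1, i ≠ j → Disjoint (tsupport (![c • f₁] i)) (tsupport (![c • f₁] j)) :=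
    fun i j hij => absurd (Subsingleton.elim i j) hij
  obtain ⟨hD, hB⟩ := hU 1 f₀ ![c • f₁] hd1 hd2 k
  -- abbreviations
  set X : GaugeConfig 4 (sch.side k) G → ℝ := fun U => smearedLatticeField r.curvature.F
    (Literature.Probability.LatticeModels.box 4 (sch.L k)) (sch.a k) (sch.c r.curvature k)
    (sch.m r.curvature k) f₀ (torusLift (sch.side k) U) with hX
  set Yc : GaugeConfig 4 (sch.side k) G → ℝ := fun U => smearedLatticeField r.curvature.F
    (Literature.Probability.LatticeModels.box 4 (sch.L k)) (sch.a k) (sch.c r.curvature k)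
    (sch.m r.curvature k) (c • f₁) (torusLift (sch.side k) U) with hYc
  set μ : Measure (GaugeConfig 4 (sch.side k) G) := wilsonMeasure r.ρ (sch.β k) with hμ
  -- the order-one polydisc function restricted to constant sources is the one-variable response
  have hsum : ∀ (s : Fin 1 → ℂ) (U : GaugeConfig 4 (sch.side k) G),
      (∑ i, s i * ((smearedLatticeField r.curvature.F
        (Literature.Probability.LatticeModels.box 4 (sch.L k)) (sch.a k) (sch.c r.curvature k)
        (sch.m r.curvature k) (![c • f₁] i) (torusLift (sch.side k) U) : ℝ) : ℂ)) =
        s 0 * ((Yc U : ℝ) : ℂ) := by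
    intro s U
    simp [hYc]
  simp only [hsum] at hD hB
  constructor
  · -- differentiability: compose with the constant embedding
    have hcomp : (fun t : ℂ => (∫ U, ((X U : ℝ) : ℂ) * Complex.exp (t * ((Yc U : ℝ) : ℂ)) ∂μ) /
        ∫ U, Complex.exp (t * ((Yc U : ℝ) : ℂ)) ∂μ) =
        (fun s : Fin 1 → ℂ => (∫ U, ((X U : ℝ) : ℂ) * Complex.exp (s 0 * ((Yc U : ℝ) : ℂ)) ∂μ) /
          ∫ U, Complex.exp (s 0 * ((Yc U : ℝ) : ℂ)) ∂μ) ∘ fun t : ℂ => fun _ : Fin 1 => t := by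
      funext t; rfl
    rw [hcomp]
    refine hD.comp ?_ fun t ht => ?_
    · exact (differentiable_pi.2 fun _ => differentiable_id).differentiableOn
    · have h1 : ε₁ / ((1 : ℕ) + 1) = ε₁ / (((1 : ℕ) : ℝ) + 1) := by norm_num
      exact const_mem_ball_fin_one (by simpa using ht)
  · intro t ht
    have ht' : (fun _ : Fin 1 => t) ∈ ball (0 : Fin 1 → ℂ) (ε₁ / ((1 : ℕ) + 1)) :=
      const_mem_ball_fin_one (by simpa using ht)
    have hb := hB (fun _ => t) ht'
    refine hb.trans (le_of_eq ?_)
    rw [Fin.prod_univ_one, Matrix.cons_val_fin_one, map_smul_eq_mul, Real.norm_of_nonneg hc.le]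
    ring

/-- **The card's typed C⁺ is incompatible with the crux's non-triviality clause.**  If
`UniformHolomorphicResponse r sch m l ε₁ C₀ C₁` holds as typed (hypothesis `hU`, `0 < ε₁`) and the
crux's convergence clause holds for `(r, sch, S)`, then the crux's TwoPointNontrivial clause for the
curvature species fails: all off-diagonal truncated lattice two-point functions of the curvature vanish
identically (`covariance_eq_zero_of_typedUniformResponse`, `stub_covBookkeeping`), so their limit is
`0` (`twoPointNontrivial_iff_lattice`).  Hence no witness of `HypercubicLimit` satisfies the card's typed
transfer target. [folklore] -/
theorem not_twoPointNontrivial_of_typedUniformResponse :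
    ∀ (G : Type) [Group G] [TopologicalSpace G] [IsTopologicalGroup G] [CompactSpace G] [MeasurableSpace
      G] [BorelSpace G] (r : LatticeRep G) (sch : SpeciesScheme (YMSpecies G)) (S :
      LabelledSchwingerFamily (YMSpecies G) (EuclideanSpace ℝ (Fin 4))) (m l : ℕ) (ε₁ : ℝ) (C₀ C₁ : ℝ)
      (hε₁ : 0 < ε₁) (hU : ∀ (n : ℕ) (f₀ : 𝓢(EuclideanSpace ℝ (Fin 4), ℝ)) (f : Fin n → 𝓢(EuclideanSpace ℝ
      (Fin 4), ℝ)), (∀ i, Disjoint (tsupport f₀) (tsupport (f i))) → (∀ i j, i ≠ j → Disjoint (tsupport (f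
      i)) (tsupport (f j))) → ∀ k : ℕ, DifferentiableOn ℂ (fun s : Fin n → ℂ => (∫ U,
      ((smearedLatticeField r.curvature.F (Literature.Probability.LatticeModels.box 4 (sch.L k)) (sch.a k)
      (sch.c r.curvature k) (sch.m r.curvature k) f₀ (torusLift (sch.side k) U) : ℝ) : ℂ) * Complex.exp (∑
      i, s i * ((smearedLatticeField r.curvature.F (Literature.Probability.LatticeModels.box 4 (sch.L k))
      (sch.a k) (sch.c r.curvature k) (sch.m r.curvature k) (f i) (torusLift (sch.side k) U) : ℝ) : ℂ))
      ∂(wilsonMeasure r.ρ (sch.β k) : Measure (GaugeConfig 4 (sch.side k) G))) / ∫ U, Complex.exp (∑ i, s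
      i * ((smearedLatticeField r.curvature.F (Literature.Probability.LatticeModels.box 4 (sch.L k))
      (sch.a k) (sch.c r.curvature k) (sch.m r.curvature k) (f i) (torusLift (sch.side k) U) : ℝ) : ℂ))
      ∂(wilsonMeasure r.ρ (sch.β k) : Measure (GaugeConfig 4 (sch.side k) G))) (ball 0 (ε₁ / (n + 1))) ∧ ∀
      s ∈ ball (0 : Fin n → ℂ) (ε₁ / (n + 1)), ‖(∫ U, ((smearedLatticeField r.curvature.F
      (Literature.Probability.LatticeModels.box 4 (sch.L k)) (sch.a k) (sch.c r.curvature k) (sch.m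
      r.curvature k) f₀ (torusLift (sch.side k) U) : ℝ) : ℂ) * Complex.exp (∑ i, s i *
      ((smearedLatticeField r.curvature.F (Literature.Probability.LatticeModels.box 4 (sch.L k)) (sch.a k)
      (sch.c r.curvature k) (sch.m r.curvature k) (f i) (torusLift (sch.side k) U) : ℝ) : ℂ))
      ∂(wilsonMeasure r.ρ (sch.β k) : Measure (GaugeConfig 4 (sch.side k) G))) / ∫ U, Complex.exp (∑ i, s
      i * ((smearedLatticeField r.curvature.F (Literature.Probability.LatticeModels.box 4 (sch.L k))
      (sch.a k) (sch.c r.curvature k) (sch.m r.curvature k) (f i) (torusLift (sch.side k) U) : ℝ) : ℂ))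
      ∂(wilsonMeasure r.ρ (sch.β k) : Measure (GaugeConfig 4 (sch.side k) G))‖ ≤ C₀ * C₁ ^ n *
      SchwartzMap.seminorm ℝ m l f₀ * ∏ i, SchwartzMap.seminorm ℝ m l (f i)) (hconv : ∀ (n : ℕ), n ≠ 0 → ∀
      (σ : Fin n → YMSpecies G) (f : Fin n → 𝓢(EuclideanSpace ℝ (Fin 4), ℝ)) (F : 𝓢((Fin n →
      EuclideanSpace ℝ (Fin 4)), ℂ)), IsTensorOf F (fun i => ofRealTest (f i)) → IsOffDiagonal F → Tendsto
      (fun k : ℕ => ((latticeSchwinger r.ρ sch (fun s => s.F) k n σ f : ℝ) : ℂ)) atTop (𝓝 (S n σ F))), ¬ ∃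
      (F₁ G₁ : 𝓢((Fin 1 → EuclideanSpace ℝ (Fin 4)), ℂ)) (H₁ : 𝓢((Fin (1 + 1) → EuclideanSpace ℝ (Fin 4)),
      ℂ)), IsTimeOrdered F₁ ∧ IsTimeOrdered G₁ ∧ IsAppendTensorOf H₁ (osAdjoint F₁) G₁ ∧ S (1 + 1) (fun _
      => r.curvature) H₁ ≠ S 1 (fun _ => r.curvature) (osAdjoint F₁) * S 1 (fun _ => r.curvature) G₁ := by
  intro G _ _ _ _ _ _ r sch S m l ε₁ C₀ C₁ hε₁ hU hconv
  rw [Summit.QuantumFields.YangMills.Theorems.HypercubicLimit.Negative.twoPointNontrivial_iff_lattice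
    r sch S hconv r.curvature]
  rintro ⟨u, v, hu, hv, hnot⟩
  apply hnot
  have hdisj : Disjoint (tsupport u) (tsupport v) := by
    refine Set.disjoint_left.2 fun y hyu hyv => ?_
    have h1 : y 0 < 0 := hu hyu
    have h2 : 0 < y 0 := hv hyv
    linarith
  have hzero : ∀ k : ℕ,
      latticeSchwinger r.ρ sch (fun s => s.F) k (1 + 1) (fun _ => r.curvature) ![u, v] -
        latticeSchwinger r.ρ sch (fun s => s.F) k 1 (fun _ => r.curvature) ![u] *
          latticeSchwinger r.ρ sch (fun s => s.F) k 1 (fun _ => r.curvature) ![v] = 0 := by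
    intro k
    have hcov := covariance_eq_zero_of_typedUniformResponse r sch m l C₀ C₁ hε₁ hU k u v hdisj
    rw [stub_covBookkeeping G r sch k u v] at hcov
    exact hcov
  simp_rw [hzero]
  exact tendsto_const_nhds

end Summit.QuantumFields.YangMills.Cruxes.HypercubicLimit.CouplingResponse

end
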